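import Summits.BirchSwinnertonDyer.BirchSwinnertonDyer.Theorems.ManinLocalTwoThreeCuspHeckeShift
import Summits.BirchSwinnertonDyer.BirchSwinnertonDyer.Theorems.ManinLocalTwoThreeShiftInvariantHeckeEigenvalue
import Summits.BirchSwinnertonDyer.BirchSwinnertonDyer.Theorems.ManinLocalTwoThreeCongruenceHomShiftInvariant
import HarnessLib

/-!
# PARABOLICITY, part 1/3: parabolic elements `h T^m h⁻¹` of `Γ₀(M)`, cusp widths, and the cusp values `u(π_y)` of an
# additive map `u : Γ₀(M) → K`

Summit `BirchSwinnertonDyer`, route `ManinLocalTwoThree` (cell bsd-f2-manin), cruxes C2 `ManinOddAtFour`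
(stmt-BirchSwinnertonDyer-22967, deciding) / C3 `ManinPrimeToThreeAtNine` (stmt-BirchSwinnertonDyer-22968).  The generation
stubs of both skeleton lines reduce to the leaf `RelativeIharaShiftVanishingBar p t n` ⟸ E-es-35 `ShiftInvariantIsDiamond`
(MEMO-es §23), whose assembly (p3, cell INBOX 2026-08-28T03:17:26Z) has ONE open hypothesis besides the landed layers:
**PARABOLICITY** (MEMO-es §22.2 step (0); refuter ref1 §R43 gap N4) — a generalised Hecke eigenclass
`u ∈ Z¹(Γ₀(M), K) = Hom(Γ₀(M), K)` whose eigenvalue system is not Eisenstein kills every element of `Γ₀(M)` fixing a cusp,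
so that it lifts to a `Γ₀(M)`-invariant cusp symbol (p2's `exists_cuspSymbol_of_parabolic_hom`).  This file is the
group-theoretic first third of its proof, over Mathlib's `OnePoint ℚ` / `mapGL ℚ` and p2's `cuspMatrix`
(`Theorems/ManinLocalTwoThreeDefs.lean`):

* `coe_conj_T_zpow`, `conj_T_zpow_mem_Gamma0`, `dvd_of_conj_T_zpow_mem_Gamma0` — the parabolic elements
  `h T^m h⁻¹ = (1 − acm, a²m; −c²m, 1 + acm)`; membership in `Γ₀(M)` iff `M ∣ c² m`;
* `eq_conj_T_zpow_or_neg_of_smul_eq` — an element of `SL₂(ℤ)` fixing the cusp `h∞` is `± h T^m h⁻¹`;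
* widths `w(c) = M / gcd(M, c²)`: `dvd_sq_mul_width` (`M ∣ c² w(c)`), `width_dvd_of_dvd_sq_mul` (`M ∣ c² m ⟹ w(c) ∣ m`),
  invariance under unit scalings / unit congruences of `c` (`width_mul_eq_of_isCoprime`, `width_eq_of_dvd_sub_mul`,
  `width_smul`);
* cusp values: with `g_y = cuspMatrix y`, `w_y = w(c_{g_y})`, `π_y = g_y T^{w_y} g_y⁻¹ ∈ Γ₀(M)`:
  `apply_conj_T_zpow_eq_zsmul` (`u(h T^{k w_y} h⁻¹) = k · u(π_y)` for every `h` with `h∞ = y`),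
  `exists_eq_mul_width_of_mem` (exponents of parabolic elements of `Γ₀(M)` at `y` are multiples of `w_y`),
  `cuspValue_smul` (`y ↦ u(π_y)` is `Γ₀(M)`-invariant).

Parts 2/3 (`…ParabolicRestrictionHecke.lean`: `(T_r u)(π_x) = r·u(π_{ρ_r x}) + u(π_{ρ_r⁻¹ x})`) and 3/3
(`…Parabolicity.lean`: the Eisenstein argument on the cusp values, p2's `boundaryEisenstein` with the weights of `ρ_r`,
`ρ_r⁻¹` exchanged) follow.  No new definitions; nothing about BSD or Manin's conjecture is proved here.

References: G. Shimura, *Introduction to the arithmetic theory of automorphic functions* (1971) §1.6 (cusps, parabolic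
elements), §8.3; cell memo HOME/MEMO-es.md §22.2 (0).
-/

set_option autoImplicit false
set_option linter.dupNamespace false

open scoped MatrixGroups

open CongruenceSubgroup Matrix.SpecialLinearGroup ModularGroup Literature.NumberTheory.EllipticCurves.ModularForms
  Literature.NumberTheory.EllipticCurves.ModularForms.HidaCohomology

namespace Summit.BirchSwinnertonDyer.BirchSwinnertonDyer.Theorems.ManinLocalTwoThree

/-! ### Conjugates of powers of `T`: the parabolic elements `h T^m h⁻¹` -/

section ConjT

/-- Entries of `h T^m h⁻¹ = (1 − a c m, a² m; −c² m, 1 + a c m)` for `h = (a b; c d) ∈ SL₂(ℤ)`. [folklore] -/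
theorem coe_conj_T_zpow (h : SL(2, ℤ)) (m : ℤ) :
    ((h * T ^ m * h⁻¹ : SL(2, ℤ)) : Matrix (Fin 2) (Fin 2) ℤ) =
      !![1 - h 0 0 * h 1 0 * m, h 0 0 ^ 2 * m; -(h 1 0 ^ 2 * m), 1 + h 0 0 * h 1 0 * m] := by
  have hdet := det_entries h
  rw [coe_mul, coe_mul, coe_inv, coe_T_zpow, Matrix.adjugate_fin_two]
  ext i j
  fin_cases i <;> fin_cases j <;> simp [Matrix.mul_apply, Fin.sum_univ_two] <;>
    first | linear_combination hdet | ring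

/-- Lower-left entry of `h T^m h⁻¹`: `−c² m`. [folklore] -/
theorem conj_T_zpow_apply_one_zero (h : SL(2, ℤ)) (m : ℤ) : (h * T ^ m * h⁻¹ : SL(2, ℤ)) 1 0 = -(h 1 0 ^ 2 * m) := by
  rw [coe_conj_T_zpow]
  rfl

/-- `h T^m h⁻¹ ∈ Γ₀(M)` as soon as `M ∣ c² m`. [folklore] -/
theorem conj_T_zpow_mem_Gamma0 {M : ℕ} {h : SL(2, ℤ)} {m : ℤ} (hd : (M : ℤ) ∣ h 1 0 ^ 2 * m) :
    h * T ^ m * h⁻¹ ∈ Gamma0 M := by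
  rw [Gamma0_mem]
  have h10 : (((h * T ^ m * h⁻¹ : SL(2, ℤ)) 1 0 : ℤ) : ZMod M) = 0 := by
    rw [conj_T_zpow_apply_one_zero, Int.cast_neg, neg_eq_zero]
    exact (ZMod.intCast_zmod_eq_zero_iff_dvd _ M).mpr hd
  exact h10

/-- Conversely `h T^m h⁻¹ ∈ Γ₀(M)` forces `M ∣ c² m`. [folklore] -/
theorem dvd_of_conj_T_zpow_mem_Gamma0 {M : ℕ} {h : SL(2, ℤ)} {m : ℤ} (hmem : h * T ^ m * h⁻¹ ∈ Gamma0 M) :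
    (M : ℤ) ∣ h 1 0 ^ 2 * m := by
  rw [Gamma0_mem] at hmem
  have h10 : (((h * T ^ m * h⁻¹ : SL(2, ℤ)) 1 0 : ℤ) : ZMod M) = 0 := hmem
  rw [conj_T_zpow_apply_one_zero, Int.cast_neg, neg_eq_zero] at h10
  exact (ZMod.intCast_zmod_eq_zero_iff_dvd _ M).mp h10

/-- `m ↦ h T^m h⁻¹` is a one-parameter group. [folklore] -/
theorem conj_T_zpow_add (h : SL(2, ℤ)) (m m' : ℤ) :
    h * T ^ (m + m') * h⁻¹ = (h * T ^ m * h⁻¹) * (h * T ^ m' * h⁻¹) := by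
  rw [zpow_add]
  group

/-- `−1 ∈ Γ₀(M)`. [folklore] -/
theorem neg_one_mem_Gamma0 (M : ℕ) : (-1 : SL(2, ℤ)) ∈ Gamma0 M := by
  rw [Gamma0_mem]
  simp

/-- **Elements of `SL₂(ℤ)` fixing the cusp `h∞` are `± h T^m h⁻¹`.** [cite: Shimura1971, §1.6] -/
theorem eq_conj_T_zpow_or_neg_of_smul_eq (γ h : SL(2, ℤ))
    (hfix : (mapGL ℚ γ : GL (Fin 2) ℚ) • (mapGL ℚ h : GL (Fin 2) ℚ) • (OnePoint.infty : OnePoint ℚ) =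
      (mapGL ℚ h : GL (Fin 2) ℚ) • OnePoint.infty) :
    ∃ m : ℤ, γ = h * T ^ m * h⁻¹ ∨ γ = -(h * T ^ m * h⁻¹) := by
  set δ : SL(2, ℤ) := h⁻¹ * γ * h with hδ
  have hδfix : (mapGL ℚ δ : GL (Fin 2) ℚ) • (OnePoint.infty : OnePoint ℚ) = OnePoint.infty := by
    rw [hδ, map_mul, map_mul, mul_smul, mul_smul, hfix, ← mul_smul, ← map_mul, inv_mul_cancel, map_one, one_smul]
  have h10 : δ 1 0 = 0 := (mapGL_smul_infty_eq_self_iff δ).mp hδfix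
  obtain ⟨hdiag, hunit⟩ := sl_diag_of_apply_one_zero δ h10
  have hγ : γ = h * δ * h⁻¹ := by rw [hδ]; group
  rcases Int.eq_one_or_neg_one_of_mul_eq_one' hunit with ⟨h00, h11⟩ | ⟨h00, h11⟩
  · refine ⟨δ 0 1, Or.inl ?_⟩
    rw [hγ]
    congr 2
    ext i j
    rw [coe_T_zpow]
    fin_cases i <;> fin_cases j <;> simp [h00, h10, h11]
  · refine ⟨-(δ 0 1), Or.inr ?_⟩
    rw [hγ, ← neg_mul, ← mul_neg]
    congr 2
    ext i j
    rw [coe_neg, coe_T_zpow]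
    fin_cases i <;> fin_cases j <;> simp [h00, h10, h11]

end ConjT

/-! ### Additive maps on `Γ₀(M)`: values on `−1`, on `−γ`, on powers -/

section Additive

variable {M : ℕ} {K : Type*} [CommRing K] {u : Gamma0 M → Fin 1 → K}

/-- `u(−γ) = u(−1) + u(γ)` for an additive `u`. [folklore] -/
theorem cocycle_zero_neg (hu : u ∈ cocycles 0 M K) (γ : SL(2, ℤ)) (hγ : γ ∈ Gamma0 M) (hγ' : -γ ∈ Gamma0 M) :
    u ⟨-γ, hγ'⟩ = u ⟨-1, neg_one_mem_Gamma0 M⟩ + u ⟨γ, hγ⟩ := by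
  rw [← cocycle_zero_mul hu]
  congr 1
  apply Subtype.ext
  simp

/-- `M ∣ c² (k m)` from `M ∣ c² m` (plumbing). [folklore] -/
theorem dvd_sq_mul_mul {M c m : ℤ} (hm : M ∣ c ^ 2 * m) (k : ℤ) : M ∣ c ^ 2 * (k * m) := by
  rw [mul_left_comm]
  exact Dvd.dvd.mul_left hm k

/-- `u(h T^{k m} h⁻¹) = k • u(h T^m h⁻¹)` for an additive `u` (one-parameter group `m ↦ h T^m h⁻¹`). [folklore] -/
theorem cocycle_zero_conj_T_zpow_mul (hu : u ∈ cocycles 0 M K) (h : SL(2, ℤ)) {m : ℤ}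
    (hm : (M : ℤ) ∣ h 1 0 ^ 2 * m) (k : ℤ) (hkm : h * T ^ (k * m) * h⁻¹ ∈ Gamma0 M) :
    u ⟨h * T ^ (k * m) * h⁻¹, hkm⟩ = k • u ⟨h * T ^ m * h⁻¹, conj_T_zpow_mem_Gamma0 hm⟩ := by
  let g : ℤ → Gamma0 M := fun x ↦ ⟨h * T ^ (x * m) * h⁻¹, conj_T_zpow_mem_Gamma0 (dvd_sq_mul_mul hm x)⟩
  have hg : ∀ x y, g (x + y) = g x * g y := by
    intro x y
    apply Subtype.ext
    show h * T ^ ((x + y) * m) * h⁻¹ = (h * T ^ (x * m) * h⁻¹) * (h * T ^ (y * m) * h⁻¹)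
    rw [add_mul, conj_T_zpow_add]
  have h1 : g 1 = ⟨h * T ^ m * h⁻¹, conj_T_zpow_mem_Gamma0 hm⟩ := by
    apply Subtype.ext
    show h * T ^ (1 * m) * h⁻¹ = h * T ^ m * h⁻¹
    rw [one_mul]
  have hk : (⟨h * T ^ (k * m) * h⁻¹, hkm⟩ : Gamma0 M) = g k := rfl
  rw [hk, cocycle_zero_apply_oneParam hu g hg k, h1]

end Additive

/-! ### Widths: the exponent `w(c) = M / gcd(M, c²)` of the stabiliser generator at a cusp with denominator `c` -/

section Width

variable (M : ℕ)

/-- `M ∣ c² · w(c)` for `w(c) = M / gcd(M, c²)`. [cite: Shimura1971, §1.6] -/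
theorem dvd_sq_mul_width (c : ℤ) : (M : ℤ) ∣ c ^ 2 * ((M / Nat.gcd M (c.natAbs ^ 2) : ℕ) : ℤ) := by
  set g := Nat.gcd M (c.natAbs ^ 2) with hg
  obtain ⟨M', hM'⟩ := Nat.gcd_dvd_left M (c.natAbs ^ 2)
  obtain ⟨C', hC'⟩ := Nat.gcd_dvd_right M (c.natAbs ^ 2)
  rw [← hg] at hM' hC'
  have hc2 : c ^ 2 = ((c.natAbs ^ 2 : ℕ) : ℤ) := by
    rw [Nat.cast_pow, Int.natAbs_sq]
  rcases Nat.eq_zero_or_pos g with h0 | hpos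
  · -- `g = 0` forces `M = 0`
    have hM0 : M = 0 := by rw [hM', h0, zero_mul]
    simp [hM0]
  · have hdiv : M / g = M' := by rw [hM', Nat.mul_div_cancel_left _ hpos]
    rw [hdiv, hc2, hC']
    refine ⟨(C' : ℤ), ?_⟩
    conv_rhs => rw [hM']
    push_cast
    ring

/-- `M ∣ c² m` forces `w(c) ∣ m` (`M ≥ 1`). [cite: Shimura1971, §1.6] -/
theorem width_dvd_of_dvd_sq_mul [NeZero M] {c m : ℤ} (h : (M : ℤ) ∣ c ^ 2 * m) :
    ((M / Nat.gcd M (c.natAbs ^ 2) : ℕ) : ℤ) ∣ m := by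
  set g := Nat.gcd M (c.natAbs ^ 2) with hg
  have hpos : 0 < g := Nat.pos_of_ne_zero fun h0 ↦ NeZero.ne M (Nat.eq_zero_of_gcd_eq_zero_left h0)
  obtain ⟨M', hM'⟩ := Nat.gcd_dvd_left M (c.natAbs ^ 2)
  obtain ⟨C', hC'⟩ := Nat.gcd_dvd_right M (c.natAbs ^ 2)
  rw [← hg] at hM' hC'
  have hdivM : M / g = M' := by rw [hM', Nat.mul_div_cancel_left _ hpos]
  have hdivC : c.natAbs ^ 2 / g = C' := by rw [hC', Nat.mul_div_cancel_left _ hpos]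
  have hcop : Nat.Coprime M' C' := by
    have h1 := Nat.coprime_div_gcd_div_gcd (m := M) (n := c.natAbs ^ 2) (by rw [← hg]; exact hpos)
    rwa [← hg, hdivM, hdivC] at h1
  rw [hdivM]
  -- in `ℕ`: `M ∣ |c|² |m|`, i.e. `g M' ∣ g C' |m|`, so `M' ∣ C' |m|`, so `M' ∣ |m|`
  have hnat : M ∣ c.natAbs ^ 2 * m.natAbs := by
    have := Int.natAbs_dvd_natAbs.mpr h
    rwa [Int.natAbs_mul, Int.natAbs_pow, Int.natAbs_natCast] at this
  rw [hM', hC', mul_assoc] at hnat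
  have h2 : M' ∣ C' * m.natAbs := Nat.dvd_of_mul_dvd_mul_left hpos hnat
  have h3 : M' ∣ m.natAbs := hcop.dvd_of_dvd_mul_left h2
  exact Int.natCast_dvd.mpr h3

/-- Two denominators with the same divisibility predicate `M ∣ c² m` have the same width. [folklore] -/
theorem width_eq_of_forall_dvd_iff [NeZero M] {c c' : ℤ} (h : ∀ m : ℤ, (M : ℤ) ∣ c ^ 2 * m ↔ (M : ℤ) ∣ c' ^ 2 * m) :
    M / Nat.gcd M (c.natAbs ^ 2) = M / Nat.gcd M (c'.natAbs ^ 2) := by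
  apply Nat.dvd_antisymm
  · exact Int.natCast_dvd_natCast.mp (width_dvd_of_dvd_sq_mul M ((h _).mpr (dvd_sq_mul_width M c')))
  · exact Int.natCast_dvd_natCast.mp (width_dvd_of_dvd_sq_mul M ((h _).mp (dvd_sq_mul_width M c)))

/-- Scaling the denominator by an integer coprime to `M` does not change the width. [folklore] -/
theorem width_mul_eq_of_isCoprime [NeZero M] {e : ℤ} (he : IsCoprime e M) (c : ℤ) :
    M / Nat.gcd M ((e * c).natAbs ^ 2) = M / Nat.gcd M (c.natAbs ^ 2) := by
  refine width_eq_of_forall_dvd_iff M fun m ↦ ⟨fun h ↦ ?_, fun h ↦ ?_⟩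
  · rw [mul_pow, mul_assoc] at h
    exact (IsCoprime.pow_right (IsCoprime.symm he)).dvd_of_dvd_mul_left h
  · rw [mul_pow, mul_assoc]
    exact Dvd.dvd.mul_left h _

/-- Denominators congruent up to a unit mod `M` have the same width. [folklore] -/
theorem width_eq_of_dvd_sub_mul [NeZero M] {c c' e e' : ℤ} (hc' : (M : ℤ) ∣ c' - e * c) (hc : (M : ℤ) ∣ c - e' * c') :
    M / Nat.gcd M (c.natAbs ^ 2) = M / Nat.gcd M (c'.natAbs ^ 2) := by
  refine width_eq_of_forall_dvd_iff M fun m ↦ ⟨fun h ↦ ?_, fun h ↦ ?_⟩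
  · have h1 : c' ^ 2 * m = (c' - e * c) * ((c' + e * c) * m) + e ^ 2 * (c ^ 2 * m) := by ring
    rw [h1]
    exact Dvd.dvd.add (Dvd.dvd.mul_right hc' _) (Dvd.dvd.mul_left h _)
  · have h1 : c ^ 2 * m = (c - e' * c') * ((c + e' * c') * m) + e' ^ 2 * (c' ^ 2 * m) := by ring
    rw [h1]
    exact Dvd.dvd.add (Dvd.dvd.mul_right hc _) (Dvd.dvd.mul_left h _)

end Width

/-! ### The stabiliser generator `π_y = g_y T^{w_y} g_y⁻¹` at a cusp `y = g_y ∞` and the cusp values `u(π_y)` -/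

section CuspValue

variable (M : ℕ) [NeZero M]

/-- Two matrices with the same cusp `h∞ = g∞` conjugate every `T^n` to the same element, and have the same `c²`.
[cite: Shimura1971, §1.6] -/
theorem conj_T_zpow_eq_of_smul_infty_eq (h g : SL(2, ℤ))
    (hx : (mapGL ℚ h : GL (Fin 2) ℚ) • (OnePoint.infty : OnePoint ℚ) = (mapGL ℚ g : GL (Fin 2) ℚ) • OnePoint.infty)
    (n : ℤ) : h * T ^ n * h⁻¹ = g * T ^ n * g⁻¹ ∧ h 1 0 ^ 2 = g 1 0 ^ 2 := by
  set δ : SL(2, ℤ) := g⁻¹ * h with hδ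
  have hδfix : (mapGL ℚ δ : GL (Fin 2) ℚ) • (OnePoint.infty : OnePoint ℚ) = OnePoint.infty := by
    rw [hδ, map_mul, mul_smul, hx, ← mul_smul, ← map_mul, inv_mul_cancel, map_one, one_smul]
  have h10 : δ 1 0 = 0 := (mapGL_smul_infty_eq_self_iff δ).mp hδfix
  obtain ⟨hdiag, hunit⟩ := sl_diag_of_apply_one_zero δ h10
  have hsq : δ 0 0 ^ 2 = 1 := by rw [sq]; nth_rewrite 2 [hdiag]; exact hunit
  have hδT : δ * T ^ n * δ⁻¹ = T ^ n := by
    ext i j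
    rw [coe_conj_T_zpow, coe_T_zpow]
    fin_cases i <;> fin_cases j <;> simp [h10, hsq]
  have hh : h = g * δ := by rw [hδ]; group
  refine ⟨?_, ?_⟩
  · calc h * T ^ n * h⁻¹ = g * (δ * T ^ n * δ⁻¹) * g⁻¹ := by rw [hh]; group
      _ = g * T ^ n * g⁻¹ := by rw [hδT]
  · have h1 : h 1 0 = g 1 0 * δ 0 0 := by
      rw [hh, coe_mul, Matrix.mul_apply, Fin.sum_univ_two, h10, mul_zero, add_zero]
    rw [h1, mul_pow, hsq, mul_one]

variable {K : Type*} [CommRing K] {u : Gamma0 M → Fin 1 → K}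

omit [NeZero M] in
/-- **Values on parabolic elements.**  For an additive `u` on `Γ₀(M)`, a matrix `h` with `h∞ = y` and an exponent
`k · w_y` (`w_y = M / gcd(M, c_y²)` the width, `g_y = cuspMatrix y`): `u(h T^{k w_y} h⁻¹) = k · u(g_y T^{w_y} g_y⁻¹)`.
[cite: Shimura1971, §1.6] -/
theorem apply_conj_T_zpow_eq_zsmul (hu : u ∈ cocycles 0 M K) (y : OnePoint ℚ) (h : SL(2, ℤ))
    (hy : (mapGL ℚ h : GL (Fin 2) ℚ) • (OnePoint.infty : OnePoint ℚ) = y) (k : ℤ)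
    (hmem : h * T ^ (k * ((M / Nat.gcd M (((cuspMatrix y) 1 0).natAbs ^ 2) : ℕ) : ℤ)) * h⁻¹ ∈ Gamma0 M) :
    u ⟨_, hmem⟩ = k • u ⟨cuspMatrix y * T ^ ((M / Nat.gcd M (((cuspMatrix y) 1 0).natAbs ^ 2) : ℕ) : ℤ) *
      (cuspMatrix y)⁻¹, conj_T_zpow_mem_Gamma0 (dvd_sq_mul_width M _)⟩ := by
  have hx : (mapGL ℚ h : GL (Fin 2) ℚ) • (OnePoint.infty : OnePoint ℚ) =
      (mapGL ℚ (cuspMatrix y) : GL (Fin 2) ℚ) • OnePoint.infty := by rw [hy, cuspMatrix_smul_infty]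
  obtain ⟨heq, -⟩ := conj_T_zpow_eq_of_smul_infty_eq h (cuspMatrix y) hx
    (k * ((M / Nat.gcd M (((cuspMatrix y) 1 0).natAbs ^ 2) : ℕ) : ℤ))
  have hmem' : cuspMatrix y * T ^ (k * ((M / Nat.gcd M (((cuspMatrix y) 1 0).natAbs ^ 2) : ℕ) : ℤ)) *
      (cuspMatrix y)⁻¹ ∈ Gamma0 M := heq ▸ hmem
  have e1 : (⟨_, hmem⟩ : Gamma0 M) = ⟨_, hmem'⟩ := Subtype.ext heq
  rw [e1]
  exact cocycle_zero_conj_T_zpow_mul hu (cuspMatrix y) (dvd_sq_mul_width M _) k hmem'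

/-- **Exponents of parabolic elements of `Γ₀(M)` at `y` are multiples of the width `w_y`.** [cite: Shimura1971, §1.6] -/
theorem exists_eq_mul_width_of_mem (y : OnePoint ℚ) (h : SL(2, ℤ))
    (hy : (mapGL ℚ h : GL (Fin 2) ℚ) • (OnePoint.infty : OnePoint ℚ) = y) {m : ℤ} (hmem : h * T ^ m * h⁻¹ ∈ Gamma0 M) :
    ∃ k : ℤ, m = k * ((M / Nat.gcd M (((cuspMatrix y) 1 0).natAbs ^ 2) : ℕ) : ℤ) := by
  have hx : (mapGL ℚ h : GL (Fin 2) ℚ) • (OnePoint.infty : OnePoint ℚ) =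
      (mapGL ℚ (cuspMatrix y) : GL (Fin 2) ℚ) • OnePoint.infty := by rw [hy, cuspMatrix_smul_infty]
  obtain ⟨-, hsq⟩ := conj_T_zpow_eq_of_smul_infty_eq h (cuspMatrix y) hx m
  have hd := dvd_of_conj_T_zpow_mem_Gamma0 hmem
  rw [hsq] at hd
  obtain ⟨k, hk⟩ := width_dvd_of_dvd_sq_mul M hd
  exact ⟨k, by rw [hk, mul_comm]⟩

/-- The width is a `Γ₀(M)`-invariant of the cusp: `w_{γ y} = w_y`. [cite: Shimura1971, §1.6] -/
theorem width_smul (γ : Gamma0 M) (y : OnePoint ℚ) :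
    M / Nat.gcd M (((cuspMatrix ((mapGL ℚ (γ : SL(2, ℤ)) : GL (Fin 2) ℚ) • y)) 1 0).natAbs ^ 2) =
      M / Nat.gcd M (((cuspMatrix y) 1 0).natAbs ^ 2) := by
  set h : SL(2, ℤ) := (γ : SL(2, ℤ)) * cuspMatrix y with hh
  have hx : (mapGL ℚ (cuspMatrix ((mapGL ℚ (γ : SL(2, ℤ)) : GL (Fin 2) ℚ) • y)) : GL (Fin 2) ℚ) •
      (OnePoint.infty : OnePoint ℚ) = (mapGL ℚ h : GL (Fin 2) ℚ) • OnePoint.infty := by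
    rw [cuspMatrix_smul_infty, hh, map_mul, mul_smul, cuspMatrix_smul_infty]
  obtain ⟨-, hsq⟩ := conj_T_zpow_eq_of_smul_infty_eq _ h hx 0
  have hsq' : (cuspMatrix ((mapGL ℚ (γ : SL(2, ℤ)) : GL (Fin 2) ℚ) • y) 1 0).natAbs ^ 2 = (h 1 0).natAbs ^ 2 := by
    rw [← Int.natAbs_pow, ← Int.natAbs_pow, hsq]
  rw [hsq']
  -- `h₁₀ = γ₁₀ a + γ₁₁ c ≡ γ₁₁ c`, `c ≡ γ₀₀ h₁₀` (mod `M`)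
  have hγ : (M : ℤ) ∣ (γ : SL(2, ℤ)) 1 0 := by
    have hmem := γ.2
    rw [Gamma0_mem] at hmem
    exact (ZMod.intCast_zmod_eq_zero_iff_dvd _ M).mp hmem
  have hdet := det_entries (γ : SL(2, ℤ))
  have h10 : h 1 0 = (γ : SL(2, ℤ)) 1 0 * (cuspMatrix y) 0 0 + (γ : SL(2, ℤ)) 1 1 * (cuspMatrix y) 1 0 := by
    rw [hh, coe_mul, Matrix.mul_apply, Fin.sum_univ_two]
  symm
  obtain ⟨t, ht⟩ := hγ
  refine width_eq_of_dvd_sub_mul M (e := (γ : SL(2, ℤ)) 1 1) (e' := (γ : SL(2, ℤ)) 0 0) ?_ ?_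
  · rw [h10]
    exact ⟨t * (cuspMatrix y) 0 0, by linear_combination ((cuspMatrix y) 0 0) * ht⟩
  · rw [h10]
    exact ⟨-(t * ((γ : SL(2, ℤ)) 0 0 * (cuspMatrix y) 0 0 + (γ : SL(2, ℤ)) 0 1 * (cuspMatrix y) 1 0)),
      by linear_combination (-(cuspMatrix y 1 0)) * hdet +
        (-((γ : SL(2, ℤ)) 0 0 * (cuspMatrix y) 0 0 + (γ : SL(2, ℤ)) 0 1 * (cuspMatrix y) 1 0)) * ht⟩

/-- **The cusp values `y ↦ u(π_y)` of an additive `u` on `Γ₀(M)` form a `Γ₀(M)`-invariant function on `P¹(ℚ)`**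
(`π_{γy} = γ π_y γ⁻¹` up to the normalisation, and `u` is a class function). [cite: Shimura1971, §1.6] -/
theorem cuspValue_smul (hu : u ∈ cocycles 0 M K) (γ : Gamma0 M) (y : OnePoint ℚ) :
    u ⟨cuspMatrix ((mapGL ℚ (γ : SL(2, ℤ)) : GL (Fin 2) ℚ) • y) *
        T ^ ((M / Nat.gcd M (((cuspMatrix ((mapGL ℚ (γ : SL(2, ℤ)) : GL (Fin 2) ℚ) • y)) 1 0).natAbs ^ 2) : ℕ) : ℤ) *
        (cuspMatrix ((mapGL ℚ (γ : SL(2, ℤ)) : GL (Fin 2) ℚ) • y))⁻¹, conj_T_zpow_mem_Gamma0 (dvd_sq_mul_width M _)⟩ =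
      u ⟨cuspMatrix y * T ^ ((M / Nat.gcd M (((cuspMatrix y) 1 0).natAbs ^ 2) : ℕ) : ℤ) * (cuspMatrix y)⁻¹,
        conj_T_zpow_mem_Gamma0 (dvd_sq_mul_width M _)⟩ := by
  set y' := (mapGL ℚ (γ : SL(2, ℤ)) : GL (Fin 2) ℚ) • y with hy'
  set h : SL(2, ℤ) := (γ : SL(2, ℤ)) * cuspMatrix y with hh
  set w : ℤ := ((M / Nat.gcd M (((cuspMatrix y) 1 0).natAbs ^ 2) : ℕ) : ℤ) with hw
  have hwy' : ((M / Nat.gcd M (((cuspMatrix y') 1 0).natAbs ^ 2) : ℕ) : ℤ) = w := by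
    rw [hw, hy', width_smul]
  have hx : (mapGL ℚ (cuspMatrix y') : GL (Fin 2) ℚ) • (OnePoint.infty : OnePoint ℚ) =
      (mapGL ℚ h : GL (Fin 2) ℚ) • OnePoint.infty := by
    rw [cuspMatrix_smul_infty, hh, map_mul, mul_smul, cuspMatrix_smul_infty]
  obtain ⟨heq, -⟩ := conj_T_zpow_eq_of_smul_infty_eq _ h hx w
  -- `g_{y'} T^{w} g_{y'}⁻¹ = h T^w h⁻¹ = γ π_y γ⁻¹`
  have hconj : h * T ^ w * h⁻¹ =
      (γ : SL(2, ℤ)) * (cuspMatrix y * T ^ w * (cuspMatrix y)⁻¹) * (γ : SL(2, ℤ))⁻¹ := by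
    rw [hh]; group
  have hmemπ : cuspMatrix y * T ^ w * (cuspMatrix y)⁻¹ ∈ Gamma0 M := conj_T_zpow_mem_Gamma0 (dvd_sq_mul_width M _)
  have e1 : (⟨cuspMatrix y' * T ^ ((M / Nat.gcd M (((cuspMatrix y') 1 0).natAbs ^ 2) : ℕ) : ℤ) * (cuspMatrix y')⁻¹,
      conj_T_zpow_mem_Gamma0 (dvd_sq_mul_width M _)⟩ : Gamma0 M) =
      γ * ⟨_, hmemπ⟩ * γ⁻¹ := by
    apply Subtype.ext
    show cuspMatrix y' * T ^ ((M / Nat.gcd M (((cuspMatrix y') 1 0).natAbs ^ 2) : ℕ) : ℤ) * (cuspMatrix y')⁻¹ =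
      (γ : SL(2, ℤ)) * (cuspMatrix y * T ^ w * (cuspMatrix y)⁻¹) * ((γ⁻¹ : Gamma0 M) : SL(2, ℤ))
    rw [hwy', heq, hconj]
    rfl
  rw [e1, cocycle_zero_mul hu, cocycle_zero_mul hu, cocycle_zero_inv hu]
  abel

end CuspValue

end Summit.BirchSwinnertonDyer.BirchSwinnertonDyer.Theorems.ManinLocalTwoThree
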